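import Mathlib
import Summits.NavierStokesRegularity.FluidComputer.AbcClassIEigenpairConjugate
import Summits.NavierStokesRegularity.FluidComputer.AbcClassIIEigenpairRow3002C
import Summits.NavierStokesRegularity.FluidComputer.CertificateAbcSpectrumThirdChain2
import Summits.NavierStokesRegularity.FluidComputer.AbcLyapunovInstability

/-!
# GROUP-B ROW OF RECORD `Row5001C` — **T4: R = 500, CLASS I, the HOPF PAIR** (implementation 3, K₀ = 28, K_V = 112)
# AS A KERNEL IMPLICATION in arbitrary COMPLEX (unitary) orbit bases (profile-cert-3 g9, 2026-08-27)
HONEST FRAMING (D-0035/D-0074): not a claim about Navier–Stokes blow-up. WHAT THIS IS NOT: not NS evidence;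
MODEL lane (NS linearised about the forced ABC flow `abcFlow 1 1 1` at viscosity `1/(2π·500)`, CLASS I = trivial
character of the 24-element group); no certificate, number or census word moves: the row below is CONDITIONAL on
the transcribed facts the 3-B-nested certifier prints (their truth = the CERTIFIER AUDIT + an AUDIT-BASIS of
implementation 3's CLASS-I basis: kit j275912 PASSED [a][b][cC][d][e][f][g] on all orbits of cube 113 — cert-3 g9's
audit_basis3_I.py 1b6e54af5342239b, HOME/profile/cert/impl3/audit_g9/; the class-II audit j268037 does not cover class I).
**`row5001C_certified_eigenvalue_of_complex_bases`** — the T4 class-I (Hopf) row of implementation 3: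
for ANY family of COMPLEX orthonormal bases of the complexified CLASS-I orbit spaces (`amc` its complex first-order
matrix, `AbcClassIComplexBasesPrep`), IF the row's facts hold for the section matrices of `amc` — a trial pair
(`λ̃ = Row5001C.lamRe + i·Row5001C.lamIm = 0.28537… + 0.64529… i`, coordinates `ṽ` on `cubeIdx 112`) with residual
`≤ Row5001C.rnorm` and tail mass `≤ NT`, an exact bordered left inverse on `cubeIdx 28` with the printed bounds
`Row5001C.alpha0 / betaB / betaC` and `GB`, and the shell number `MU2L` on `cubeIdx 29 ∖ cubeIdx 28` (every
constant of `CertificateAbcSpectrumThirdChain.Row5001C` BY NAME; `GB`, `NT`, `MU2L` = the exact binary64 of the JSON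
fields `gB_hi`, `vt_norm_hi`, `MU2_b0_lo` of HOME/profile/cert/impl3/j252101/impl3_R500_I_K028.json, inline) — THEN
`L₃₀₀|I` has an eigenvalue `λ⋆` with `|λ⋆ − λ̃| ≤ Row5001C.rho` (5.859e-09), `Re λ⋆ > 0` (`Row5001C.unstable`) AND
`Im λ⋆ > 0` (`Row5001C.hopf`: a GENUINELY COMPLEX eigenvalue — with `L` real, `conj λ⋆` is its partner), with `2πλ⋆`
an eigenvalue of the tree's linearised operator (`Torus.IsLinNSEigenvalue`) AND SO IS `2π·conj λ⋆` (the PAIR,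
`AbcClassIEigenpairConjugate`), ISOLATED within `Row5001C.rIso` in
`amc`-coordinates, and (+ FPS06 Thm 2.2) the forced ABC flow is Lyapunov-UNSTABLE at viscosity `1/(2π·500)` (rung
R-α via a complex eigenvalue of positive real part). The REALITY clause of the general theorem is not invoked. The
numeric closings (μ > 0, κ < 1, tail constant, M ≤ M0) are DISCHARGED in the kernel from the g3 chain
(`Row5001C.chain_real`, `kappa_lt_one`, `unstable`, `hopf`); `backSubst_anti` is cert-3 g7's. Mathlib + the files
named; no new definitions. bears_on LADDER-NS N5 / Z4-a(1) (**T4 row**), N1* R-α.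
-/

noncomputable section

open scoped BigOperators ComplexConjugate InnerProductSpace
open Finset

namespace Summit.NavierStokesRegularity.FluidComputer.AbcClassIEigenpair

open Literature.Analysis.FunctionSpaces Literature.Analysis.FunctionSpaces.Torus
open Literature.Analysis.FluidPDE
open Summit.NavierStokesRegularity.FluidComputer.AbcClassI
open Summit.NavierStokesRegularity.FluidComputer.AbcClassII (Fam crossForm secOp rotR rotS sgnOrbit cube extend
  restrictTo Orbit toOrbit onormSq osupNorm cubeOrbits nbrOrbits mem_nbrOrbits mem_nbrOrbits_comm toOrbit_eq_iff
  mem_cubeOrbits onormSq_nonneg neg_mem_of_orbitClosed inner_eq_sum_extend extend_apply_of_mem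
  extend_apply_of_not_mem sq_osupNorm_le_onormSq kdot_cut sum_cube_filter_eq mem_sgnOrbit_self)
open Summit.NavierStokesRegularity.FluidComputer.CertificateAbcSpectrum

section Row

variable (wf : Idx → Fam)
variable (hws : ∀ i : Idx, ∀ k ∉ i.1.1, wf i k = 0)
variable (hwt : ∀ (i : Idx) (k : Fin 3 → ℤ), ∑ j : Fin 3, ((k j : ℤ) : ℂ) * wf i k j = 0)
variable (hwI : ∀ i : Idx, IsClassI (wf i))
variable (hwon : ∀ (O : Orbit) (a b : Fin (odim O)),
  ∑ k ∈ O.1, (inner ℂ (wf ⟨O, a⟩ k) (wf ⟨O, b⟩ k) : ℂ) = if a = b then 1 else 0)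
variable (amc : Idx → Idx → ℂ)
variable (hamc : ∀ i j : Idx, amc i j =
  ∑ k ∈ i.1.1, (inner ℂ (wf i k) (Torus.lerayCoeff k (crossForm 1 1 1 (wf j) k)) : ℂ))

include hws hwt hwI hwon hamc in
/-- **Row5001C (T4: R = 500, CLASS I — the Hopf pair `λ ≈ 0.2854 ± 0.6453 i`, implementation 3) ⇒ a certified, genuinely
complex (`Im λ⋆ > 0`), unstable (`Re λ⋆ > 0`), isolated eigenvalue of `L₃₀₀|I` and rung R-α**, CONDITIONAL on the row's
transcribed facts in the certifier's own COMPLEX orbit basis. -/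
theorem row5001C_certified_eigenvalue_of_complex_bases
    (vt : AbcClassI.Idx → ℂ) (hvt0 : ∀ i, i ∉ AbcClassI.cubeIdx 112 → vt i = 0)
    (hres : ∑ i ∈ AbcClassI.cubeIdx 112 ∪ (AbcClassI.cubeIdx 112).biUnion AbcClassI.nbrIdx,
      ‖(if i ∈ AbcClassI.cubeIdx 112 then (((((Row5001C.lamRe : ℚ) : ℝ) : ℂ) + (((Row5001C.lamIm : ℚ) : ℝ) : ℂ) * Complex.I) - ((-(onormSq i.1 / 500) : ℝ) : ℂ)) * vt i
          else 0) - ∑ j ∈ AbcClassI.cubeIdx 112, amc i j * vt j‖ ^ 2 ≤ ((Row5001C.rnorm : ℚ) : ℝ) ^ 2)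
    (hntb : ∑ i ∈ AbcClassI.cubeIdx 112 \ AbcClassI.cubeIdx 28, ‖vt i‖ ^ 2 ≤
      (((8161754834082577 : ℚ) / 1152921504606846976 : ℚ) : ℝ) ^ 2)
    (Binv : ((↥(AbcClassI.cubeIdx 28) → ℂ) × ℂ) →ₗ[ℂ] ((↥(AbcClassI.cubeIdx 28) → ℂ) × ℂ))
    (hBinv : ∀ (c : ↥(AbcClassI.cubeIdx 28) → ℂ) (m : ℂ),
      Binv (fun i : ↥(AbcClassI.cubeIdx 28) =>
          (((((Row5001C.lamRe : ℚ) : ℝ) : ℂ) + (((Row5001C.lamIm : ℚ) : ℝ) : ℂ) * Complex.I) - ((-(onormSq i.1.1 / 500) : ℝ) : ℂ)) * c i -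
          ∑ j : ↥(AbcClassI.cubeIdx 28), amc i j * c j + m * vt i,
        ∑ i : ↥(AbcClassI.cubeIdx 28), conj (vt i) * c i) = (c, m))
    (hαM : ∀ (c : ↥(AbcClassI.cubeIdx 28) → ℂ) (g : ℂ),
      ∑ j : ↥(AbcClassI.cubeIdx 28), ‖(Binv (c, g)).1 j‖ ^ 2 + ‖(Binv (c, g)).2‖ ^ 2 ≤
        ((Row5001C.alpha0 : ℚ) : ℝ) ^ 2 * (∑ i : ↥(AbcClassI.cubeIdx 28), ‖c i‖ ^ 2 + ‖g‖ ^ 2))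
    (hβBM : ∀ w : AbcClassI.Idx → ℂ,
      ∑ j : ↥(AbcClassI.cubeIdx 28), ‖(Binv (fun i : ↥(AbcClassI.cubeIdx 28) => -∑ j ∈ AbcClassI.nbrIdx i \ AbcClassI.cubeIdx 28,
          amc i j * w j, 0)).1 j‖ ^ 2 +
        ‖(Binv (fun i : ↥(AbcClassI.cubeIdx 28) => -∑ j ∈ AbcClassI.nbrIdx i \ AbcClassI.cubeIdx 28,
          amc i j * w j, 0)).2‖ ^ 2 ≤
        ((Row5001C.betaB : ℚ) : ℝ) ^ 2 * ∑ j ∈ (AbcClassI.cubeIdx 28).biUnion AbcClassI.nbrIdx \ AbcClassI.cubeIdx 28, ‖w j‖ ^ 2)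
    (hβCM : ∀ (c : ↥(AbcClassI.cubeIdx 28) → ℂ) (g : ℂ),
      ∑ i ∈ ((AbcClassI.cubeIdx 28).biUnion AbcClassI.nbrIdx ∪ AbcClassI.cubeIdx 112) \ AbcClassI.cubeIdx 28,
        ‖-∑ j : ↥(AbcClassI.cubeIdx 28), amc i j * (Binv (c, g)).1 j +
          (Binv (c, g)).2 * vt i‖ ^ 2 ≤
        ((Row5001C.betaC : ℚ) : ℝ) ^ 2 * (∑ i : ↥(AbcClassI.cubeIdx 28), ‖c i‖ ^ 2 + ‖g‖ ^ 2))
    (hgBM : ∀ w : AbcClassI.Idx → ℂ,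
      ‖(Binv (fun i : ↥(AbcClassI.cubeIdx 28) => ∑ j ∈ AbcClassI.nbrIdx i \ AbcClassI.cubeIdx 28,
          amc i j * w j, 0)).2‖ ^ 2 ≤
        (((3449790300190025 : ℚ) / 2251799813685248 : ℚ) : ℝ) ^ 2 *
          ∑ j ∈ (AbcClassI.cubeIdx 28).biUnion AbcClassI.nbrIdx \ AbcClassI.cubeIdx 28, ‖w j‖ ^ 2)
    (hshellM : ∀ w : AbcClassI.Idx → ℂ, (∀ i ∈ AbcClassI.cubeIdx 28, w i = 0) →
      (((4982293683959657 : ℚ) / 9007199254740992 : ℚ) : ℝ) * ∑ i ∈ AbcClassI.cubeIdx (28 + 1) \ AbcClassI.cubeIdx 28, ‖w i‖ ^ 2 ≤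
        ∑ i ∈ AbcClassI.cubeIdx (28 + 1) \ AbcClassI.cubeIdx 28,
          (((((Row5001C.lamRe : ℚ) : ℝ) : ℂ) + (((Row5001C.lamIm : ℚ) : ℝ) : ℂ) * Complex.I).re - (-(onormSq i.1 / 500)) - Real.sqrt 2) * ‖w i‖ ^ 2 -
        RCLike.re (∑ i ∈ (AbcClassI.cubeIdx 28).biUnion AbcClassI.nbrIdx \ AbcClassI.cubeIdx 28,
          conj (∑ j : ↥(AbcClassI.cubeIdx 28), amc i j *
            (Binv (fun i : ↥(AbcClassI.cubeIdx 28) => ∑ j ∈ AbcClassI.nbrIdx i \ AbcClassI.cubeIdx 28,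
              amc i j * w j, 0)).1 j) * w i)) :
    ∃ lam : ℂ, ‖lam - ((((Row5001C.lamRe : ℚ) : ℝ) : ℂ) + (((Row5001C.lamIm : ℚ) : ℝ) : ℂ) * Complex.I)‖ ≤
        ((Row5001C.rho : ℚ) : ℝ) ∧ 0 < lam.re ∧ 0 < lam.im ∧
      Torus.IsLinNSEigenvalue (1 / (2 * Real.pi * 500)) (Torus.abcFlow 1 1 1) (2 * Real.pi * lam) ∧
      Torus.IsLinNSEigenvalue (1 / (2 * Real.pi * 500)) (Torus.abcFlow 1 1 1) (2 * Real.pi * conj lam) ∧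
      (∀ z : ℂ, z ≠ lam → ‖z - lam‖ < ((Row5001C.rIso : ℚ) : ℝ) →
        ∀ w : AbcClassI.Idx → ℂ, (Summable fun i : AbcClassI.Idx => (1 + onormSq i.1 / 500) ^ 2 * ‖w i‖ ^ 2) →
          (∀ i : AbcClassI.Idx, ((-(onormSq i.1 / 500) : ℝ) : ℂ) * w i +
            ∑ j ∈ AbcClassI.nbrIdx i, amc i j * w j = z * w i) → w = 0) ∧
      (Torus.fps2006_nonlinear_instability_of_eigenvalue →
        Torus.IsLyapunovUnstableSteadyState (1 / (2 * Real.pi * 500))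
          (fun x => (4 * Real.pi ^ 2 * (1 / (2 * Real.pi * 500))) • Torus.abcFlow 1 1 1 x)
          (Torus.abcFlow 1 1 1)) := by
  -- the row's constants
  set lt : ℂ := ((((Row5001C.lamRe : ℚ) : ℝ) : ℂ) + (((Row5001C.lamIm : ℚ) : ℝ) : ℂ) * Complex.I) with hlt
  set α : ℝ := ((Row5001C.alpha0 : ℚ) : ℝ) with hαdef
  set βB : ℝ := ((Row5001C.betaB : ℚ) : ℝ) with hβBdef
  set βC : ℝ := ((Row5001C.betaC : ℚ) : ℝ) with hβCdef
  set gB : ℝ := (((3449790300190025 : ℚ) / 2251799813685248 : ℚ) : ℝ) with hgBdef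
  set nt : ℝ := (((8161754834082577 : ℚ) / 1152921504606846976 : ℚ) : ℝ) with hntdef
  set MU2 : ℝ := (((4982293683959657 : ℚ) / 9007199254740992 : ℚ) : ℝ) with hMU2def
  set r₀ : ℝ := ((Row5001C.rnorm : ℚ) : ℝ) with hr₀def
  set μ : ℝ := MU2 - gB * nt with hμdef
  set M : ℝ := √((1 + βC ^ 2) / μ ^ 2 + (α + βB * √(1 + βC ^ 2) / μ) ^ 2) with hMdef
  have hlt_re : lt.re = ((Row5001C.lamRe : ℚ) : ℝ) := by rw [hlt]; simp
  have hlt_im : lt.im = ((Row5001C.lamIm : ℚ) : ℝ) := by rw [hlt]; simp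
  have hα0 : 0 ≤ α := by rw [hαdef]; exact_mod_cast (by norm_num [Row5001C.alpha0] : (0 : ℚ) ≤ Row5001C.alpha0)
  have hβB0 : 0 ≤ βB := by rw [hβBdef]; exact_mod_cast (by norm_num [Row5001C.betaB] : (0 : ℚ) ≤ Row5001C.betaB)
  have hβC0 : 0 ≤ βC := by rw [hβCdef]; exact_mod_cast (by norm_num [Row5001C.betaC] : (0 : ℚ) ≤ Row5001C.betaC)
  have hgB0 : 0 ≤ gB := by rw [hgBdef]; exact_mod_cast (by norm_num : (0 : ℚ) ≤ 3449790300190025 / 2251799813685248)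
  have hnt0 : 0 ≤ nt := by rw [hntdef]; exact_mod_cast (by norm_num : (0 : ℚ) ≤ 8161754834082577 / 1152921504606846976)
  have hr₀0 : 0 ≤ r₀ := by rw [hr₀def]; exact_mod_cast (by norm_num [Row5001C.rnorm] : (0 : ℚ) ≤ Row5001C.rnorm)
  -- the printed `μ_eff` is below the exact `MU2 − gB·nt`, and positive
  have hmuμ : ((Row5001C.mu : ℚ) : ℝ) ≤ μ := by
    rw [hμdef, hMU2def, hgBdef, hntdef]
    exact_mod_cast (by norm_num [Row5001C.mu] :
      Row5001C.mu ≤ (4982293683959657 : ℚ) / 9007199254740992 -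
        3449790300190025 / 2251799813685248 * (8161754834082577 / 1152921504606846976))
  have hmu0 : 0 < ((Row5001C.mu : ℚ) : ℝ) := by exact_mod_cast Row5001C.mu_pos
  have hμ : 0 < μ := lt_of_lt_of_le hmu0 hmuμ
  -- `M ≤ B := backSubstConst α₀ μ_eff β_B β_C′ ≤ M0` and the chain
  have hMB : M ≤ backSubstConst Row5001C.alpha0 Row5001C.mu Row5001C.betaB Row5001C.betaC := by
    rw [hMdef, backSubstConst, hαdef, hβBdef, hβCdef]
    exact AbcClassIIEigenpair.backSubst_anti hα0 hβB0 hmu0 hmuμ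
  obtain ⟨-, hBρ, hBκ, hBiso⟩ := Row5001C.chain_real
  have hB0 : 0 < backSubstConst Row5001C.alpha0 Row5001C.mu Row5001C.betaB Row5001C.betaC := by
    rw [backSubstConst]
    refine Real.sqrt_pos.mpr (add_pos_of_pos_of_nonneg ?_ (sq_nonneg _))
    have : 0 < ((Row5001C.mu : ℚ) : ℝ) := hmu0
    positivity
  have hM0 : 0 ≤ M := by rw [hMdef]; exact Real.sqrt_nonneg _
  have hκ1 : ((Row5001C.kappa : ℚ) : ℝ) < 1 := by exact_mod_cast Row5001C.kappa_lt_one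
  have hκM : 2 * Real.sqrt 2 * M ^ 2 * r₀ ≤ ((Row5001C.kappa : ℚ) : ℝ) := by
    refine le_trans ?_ hBκ
    have : M ^ 2 ≤ backSubstConst Row5001C.alpha0 Row5001C.mu Row5001C.betaB Row5001C.betaC ^ 2 :=
      pow_le_pow_left₀ hM0 hMB 2
    have h2 : 0 ≤ 2 * Real.sqrt 2 := by positivity
    exact mul_le_mul_of_nonneg_right (mul_le_mul_of_nonneg_left this h2) hr₀0
  have hκ : 2 * Real.sqrt 2 * M ^ 2 * r₀ < 1 := lt_of_le_of_lt hκM hκ1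
  have hρ : 2 * M * r₀ ≤ ((Row5001C.rho : ℚ) : ℝ) := by
    refine le_trans ?_ hBρ
    exact mul_le_mul_of_nonneg_right (mul_le_mul_of_nonneg_left hMB zero_le_two) hr₀0
  have hiso : ((Row5001C.rIso : ℚ) : ℝ) ≤ (1 - 2 * Real.sqrt 2 * M ^ 2 * r₀) / M := by
    by_cases hMz : M = 0
    · -- degenerate: then `2√2 M² r₀ = 0` and the right side is `1/0 = 0`... excluded: M > 0 since α ≥ 0? use M ≥ 1/... 
      exfalso
      rw [hMdef] at hMz
      have := Real.sqrt_eq_zero'.mp hMz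
      have h1 : 0 < (1 + βC ^ 2) / μ ^ 2 := by positivity
      nlinarith [sq_nonneg (α + βB * √(1 + βC ^ 2) / μ)]
    have hMpos : 0 < M := lt_of_le_of_ne hM0 (Ne.symm hMz)
    calc ((Row5001C.rIso : ℚ) : ℝ)
        ≤ (1 - ((Row5001C.kappa : ℚ) : ℝ)) /
            backSubstConst Row5001C.alpha0 Row5001C.mu Row5001C.betaB Row5001C.betaC := hBiso
      _ ≤ (1 - 2 * Real.sqrt 2 * M ^ 2 * r₀) /
            backSubstConst Row5001C.alpha0 Row5001C.mu Row5001C.betaB Row5001C.betaC :=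
          div_le_div_of_nonneg_right (by linarith) hB0.le
      _ ≤ (1 - 2 * Real.sqrt 2 * M ^ 2 * r₀) / M :=
          div_le_div_of_nonneg_left (by linarith) hMpos hMB
  -- the tail constant: `MU2 ≤ Re λ̃ + 30²/500 − √2`
  have hs : Real.sqrt 2 < 1.41422 := (Real.sqrt_lt' (by norm_num)).mpr (by norm_num)
  have htailK : MU2 ≤ lt.re + ((28 : ℝ) + 2) ^ 2 / 500 - Real.sqrt 2 := by
    rw [hlt_re, hMU2def]
    have : (((4982293683959657 : ℚ) / 9007199254740992 : ℚ) : ℝ) + 1.41422 ≤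
        ((Row5001C.lamRe : ℚ) : ℝ) + ((28 : ℝ) + 2) ^ 2 / 500 := by
      have h := (by norm_num [Row5001C.lamRe] :
        (4982293683959657 : ℚ) / 9007199254740992 + 141422 / 100000 ≤ Row5001C.lamRe + (28 + 2) ^ 2 / 500)
      have h' : (((4982293683959657 : ℚ) / 9007199254740992 + 141422 / 100000 : ℚ) : ℝ) ≤
          ((Row5001C.lamRe + (28 + 2) ^ 2 / 500 : ℚ) : ℝ) := by exact_mod_cast h
      push_cast at h'
      linarith
    linarith
  -- the general theorem
  obtain ⟨lam, hclose, heig, hisol, -, wc, hwc0, hcoordw, hwsumw⟩ :=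
    isLinNSEigenvalue_near_of_nested_certificate_of_complex_bases wf hws hwt hwI hwon amc hamc (R := 500) (by norm_num) 28 112 lt
      vt hvt0 hr₀0 hnt0 hres hntb Binv hBinv hα0 hβB0 hβC0 hgB0 hαM hβBM hβCM hgBM hshellM htailK hμdef hμ
      hMdef hκ
  have heigc := isLinNSEigenvalue_conj_of_amc_coords wf hws hwt hwI hwon amc hamc (R := 500) (by norm_num) lam wc
    hwc0 hcoordw hwsumw
  have hclose' : ‖lam - lt‖ ≤ ((Row5001C.rho : ℚ) : ℝ) := hclose.trans hρ
  have hre : 0 < lam.re := by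
    have h1 : |(lam - lt).re| ≤ ‖lam - lt‖ := Complex.abs_re_le_norm _
    rw [Complex.sub_re, hlt_re] at h1
    have h2 : 0 < ((Row5001C.lamRe : ℚ) : ℝ) - ((Row5001C.rho : ℚ) : ℝ) := by
      exact_mod_cast Row5001C.unstable
    have h3 := (abs_le.mp (h1.trans hclose')).1
    linarith
  have him : 0 < lam.im := by
    have h1 : |(lam - lt).im| ≤ ‖lam - lt‖ := Complex.abs_im_le_norm _
    rw [Complex.sub_im, hlt_im] at h1
    have h2 : 0 < ((Row5001C.lamIm : ℚ) : ℝ) - ((Row5001C.rho : ℚ) : ℝ) := by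
      exact_mod_cast Row5001C.hopf
    have h3 := (abs_le.mp (h1.trans hclose')).1
    linarith
  refine ⟨lam, hclose', hre, him, heig, heigc, fun z hz hzr => hisol z hz (lt_of_lt_of_le hzr hiso), fun hFPS => ?_⟩
  have hν : 0 < 1 / (2 * Real.pi * (500 : ℝ)) := by positivity
  have hμre : 0 < (2 * Real.pi * lam : ℂ).re := by
    have e1 : (2 * Real.pi * lam : ℂ).re = 2 * Real.pi * lam.re := by
      simp [Complex.mul_re]
    rw [e1]; positivity
  exact AbcLyapunovInstability.isLyapunovUnstable_abcFlow_of_eigenvalue hFPS hν 1 1 1 hμre heig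

end Row

end Summit.NavierStokesRegularity.FluidComputer.AbcClassIEigenpair

end
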